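import Summits.Ventures.Crystal3D.Bulk.HalfTanCertZ
import HarnessLib

/-!
# The Tammes-bridge certificate replayed by the KERNEL, blocks 1–3 (rows 0–55)

Venture `Crystal3D` (cell `pub-crystal3d`, phase 2; seat p3; certificate design and data by seat idea-2,
`phase2/idea2/TAMMES-BRIDGE.md` §F). `HalfTanCertZ.lean` states idea-2's box rule in exact natural-number arithmetic
(`CertZ.certRowsZ`); the Lean kernel EVALUATES it (`decide +kernel`, standard axioms — no `native_decide`), the `253` rows in
seven blocks of `≈ 10⁵` box evaluations (`673 651` in all, `≈ 25–45 s` of kernel time per block on the farm) spread over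
`HalfTanCertZRows1.lean`, `HalfTanCertZRows2.lean` and `HalfTanCertZAll.lean` (which unpacks the blocks into `certRowZ_true` /
`certPairZ_true`). Together with `HalfTanSoundZ*.lean` this replaces the compiled replay `CertW.certAll_true` (`native_decide`,
axiom `Lean.ofReduceBool`) of `HalfTanCert.lean` on the path to `HalfTanWitness 0.63 0.957`.
This file: blocks 1–3.
HONEST FRAMING: a computation checked by the kernel's definitional evaluation (GMP-backed `Nat` primitives); nothing geometric is
proved here; the bridge's one named hypothesis `musinTarasov2012_tammes_thirteen` is untouched.
-/

namespace Summit.Ventures.Crystal3D.TammesBridge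

namespace CertZ

/-- Rows `0 ≤ ka < 31` of the integer certificate (kernel evaluation, ≈ 10⁵ box evaluations). [folklore] -/
theorem certRowsZ_0_31 : certRowsZ 0 31 = true := by
  decide +kernel

/-- Rows `31 ≤ ka < 45` of the integer certificate (kernel evaluation, ≈ 10⁵ box evaluations). [folklore] -/
theorem certRowsZ_31_45 : certRowsZ 31 45 = true := by
  decide +kernel

/-- Rows `45 ≤ ka < 56` of the integer certificate (kernel evaluation, ≈ 10⁵ box evaluations). [folklore] -/
theorem certRowsZ_45_56 : certRowsZ 45 56 = true := by
  decide +kernel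

end CertZ

end Summit.Ventures.Crystal3D.TammesBridge
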